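import Summits.QuantumFields.YangMills.Theorems.SwapVirialDeficitBlowUpScaling
import Summits.QuantumFields.YangMills.Theorems.SwapVirialDeficitBlowUpPeriodicLeaderChart
import Summits.QuantumFields.YangMills.Theorems.VirialFluxGapRingGaugeAction
import HarnessLib

/-!
# The PERIODIC massive-mode rung, brick PS: the SCALING IDENTITY of the zero-flux ring deficit on the blow-up space —
# `μ_L{F_z ≤ s} = ofReal(coneConst^{6L⁴} · t^{18L⁴−3}) · (cone ⊗ (vol³ ⊗ vol^{Fol}))(periodicBlowUpSet z χ t s)` for EVERY `t > 0`, EXACTLY,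
# with the HUB integral kept outermost for the log-shell
# (free-hands support of ⟨stmt-QuantumFields-24196⟩ `SwapVirialDeficit.ToronSoftnessSharp`; periodic twin of fcl-p3 g45's ✓`BlowUpRing.ringMeasure_swapDeficit_le_eq_blowUp`;
# memo `w3-g64-memo-24196-periodic-massive-mode-rung.md` §2 PS)

The ring chart of w2 g57 is stated for a GENERAL gauge-invariant integrand (✓`BlowUpRing.lintegral_ringMeasure_eq_chart κ χ`), so it serves the PERIODIC
deficit `F_z = ringDeficit L z` (✓`VirialFluxGap.RingDeficit`) with the trivial seam map `κ = id` (✓`ringDeficit_ringGaugeAct`).  Composing it with the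
periodic leader chart ✓`BlowUp.lintegral_haar_four_eq_periodicLeaderChart` (PJ2: hub axial, the three non-hub leaders transversally dilated, `t⁶`) and the
follower chart ✓`BlowUp.lintegral_haar_pi_eq_followerChart` (J1 verbatim, `t^{3(6L⁴−3)}`):
* §1 `periodicChartDeficit z χ q := F_z (fixHistory (ringConfig χ q))`; ★ `periodicChartDeficit_conj` (invariance under simultaneous conjugation of leaders and
  followers, central `χ`: ✓`ringConfig_conj` + ✓`ringDeficit_ringGaugeAct` with a constant field), ★★ `pi_periodicChartDeficit_le_conj` (the inner mass is a
  class function of the leaders), ★★ `ringMeasure_ringDeficit_le_eq_chart` / `…_eq_lintegral` (`μ_L{F_z ≤ s} = ∫ Haar^{Fol}{U | … ≤ s} dHaar⁴(C)`);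
* §2 `periodicBlowUpPoint t x = (axialLetters (x.1, dil3P t x.2.1), fun i => Q (dilateIm t (x.2.2 i)))`, `periodicBlowUpSet z χ t s`, measurability;
* §3 ★ `pi_periodicChartDeficit_le_eq_followerChart` (inner mass through J1);
* §4 ★★★ `ringMeasure_ringDeficit_le_eq_periodicBlowUp` (`κ = coneConst^{6L⁴}`, Jacobian `t^{6 + 3(6L⁴−3)} = t^{18L⁴−3}`), ★★★ `…_eq_hub` — the same with
  the hub integral OUTERMOST: `μ_L{F_z ≤ s} = ofReal(…) · ∫⁻ a, (vol³ ⊗ vol^{Fol})(hub section at a) ∂cone` (the log-shell ✓`BlowUp.tendsto_div_log_of_twoScale`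
  integrates the hub LAST), and ★★ `…_eq_scaling` at `t = √u`: `u^{9L⁴−3/2}` as a real power — the periodic exponent, NO log in the Jacobian.
Deliberately NOT here: the hub's radial coordinates and second rescaling (PH), the two-scale dominator (PD) and limit (PM), the assembly (PJ6).
HONEST LABEL: measure-theoretic bookkeeping on a fixed lattice (plumbing for a plan-level fixed-`L` rung of a DRAFT line); NOT ⟨24196⟩/⟨24497⟩; own crux
⟨22884⟩ OPEN (blocked-on ⟨19935⟩); the Yang–Mills mass gap is NOT proved; no summit is proved by a line.
Width seat ym-line-sfw-p2-w3 g64 (cell ym-idea-1, free hands), `--supports stmt-QuantumFields-24196`.  Three `def`s, standard axioms, 0 `sorry`.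
References: [cite: tHooft1979]; [cite: Luscher1983, §2]; [cite: SeilerLNP1982, §2]; [folklore].
-/

set_option autoImplicit false

noncomputable section

open MeasureTheory Quaternion Set
open scoped Quaternion ENNReal BigOperators
open Literature.MathematicalPhysics.QuantumLattice
open Literature.MathematicalPhysics.QuantumFieldTheory hiding SU2
open Summit.QuantumFields.YangMills.Theorems.SwapTwistDeficit.ToronLog

attribute [local instance] Literature.Analysis.FluidPDE.Tao2016.quatMeasurableSpace
  Literature.Analysis.FluidPDE.Tao2016.quatBorelSpace
  Literature.MathematicalPhysics.QuantumLattice.secondCountableTopology_su2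

namespace Summit.QuantumFields.YangMills.Theorems.SwapVirialDeficit.BlowUpRing

open Summit.QuantumFields.YangMills.Theorems.FemtoTransferGap
open Summit.QuantumFields.YangMills.Theorems.FemtoTransferGap.TT
open Summit.QuantumFields.YangMills.Theorems.VirialFluxGap.RingDeficit
open Summit.QuantumFields.YangMills.Theorems.SwapVirialDeficit.ZeroModeSigma (ball3 measurableSet_ball3 dilateIm continuous_dilateIm)
open Summit.QuantumFields.YangMills.Theorems.SwapVirialDeficit.BlowUp (axialLetters measurable_axialLetters dil3P measurable_dil3P
  lintegral_haar_four_eq_periodicLeaderChart lintegral_haar_pi_eq_followerChart)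

variable {L : ℕ} [NeZero L]

/-! ## §1 The periodic deficit in leader ∕ follower coordinates; the inner mass is a class function -/

variable (L) in
/-- **The periodic (zero-flux ring) deficit in chart coordinates**: `F_z (glue w ∷ r, g)` with `(w, (r, g)) = ringConfig χ (C, U)` (✓`VirialFluxGap.RingDeficit.ringDeficit`,
w2 g57's ✓`ringConfig`). [cite: Luscher1983, §2] -/
def periodicChartDeficit (z : Fin 3 → Bool) (χ : Site 3 L → SU2) (q : (Fin 4 → SU2) × (Fol L → SU2)) : ℝ :=
  ringDeficit L z (fixHistory (ringConfig χ q))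

/-- `periodicChartDeficit` is measurable. [folklore] -/
theorem measurable_periodicChartDeficit (z : Fin 3 → Bool) (χ : Site 3 L → SU2) : Measurable (periodicChartDeficit L z χ) :=
  (measurable_ringDeficit z).comp (measurable_fixHistory.comp (measurable_ringConfig χ))

/-- `0 ≤ periodicChartDeficit`. [cite: Luscher1983, §2] -/
theorem periodicChartDeficit_nonneg (z : Fin 3 → Bool) (χ : Site 3 L → SU2) (q : (Fin 4 → SU2) × (Fol L → SU2)) : 0 ≤ periodicChartDeficit L z χ q :=
  ringDeficit_nonneg z _

/-- ★ **`periodicChartDeficit` is invariant under simultaneous conjugation of leaders and followers** (central `χ`): the constant gauge transformation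
`k` acts on the rebuilt ring history as the periodic gauge action, under which `F_z` is invariant (✓`ringConfig_conj`, ✓`ringDeficit_ringGaugeAct`). [cite: tHooft1979] -/
theorem periodicChartDeficit_conj (z : Fin 3 → Bool) {χ : Site 3 L → SU2} (hχ : ∀ (x : Site 3 L) (k : SU2), k * χ x = χ x * k) (k : SU2)
    (q : (Fin 4 → SU2) × (Fol L → SU2)) :
    periodicChartDeficit L z χ ((fun m => k * q.1 m * k⁻¹), (fun i => k * q.2 i * k⁻¹)) = periodicChartDeficit L z χ q := by
  unfold periodicChartDeficit fixHistory
  rw [ringConfig_conj hχ k q]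
  have h := ringDeficit_ringGaugeAct (L := L) z (fun _ : Site 3 L => k) (fixHistory (ringConfig χ q))
  unfold fixHistory at h
  refine Eq.trans ?_ h
  congr 1
  refine Prod.ext ?_ ?_
  · funext i
    refine Fin.cases ?_ (fun j => ?_) i
    · simp only [Fin.cons_zero, glue_conj']
    · simp only [Fin.cons_succ]
  · funext x
    simp only [Pi.mul_apply, Pi.inv_apply]

/-- ★★ **THE PERIODIC INNER MASS IS A CLASS FUNCTION OF THE LEADERS** (central `χ`):
`Haar^{Fol}{U | periodicChartDeficit (kCk⁻¹, U) ≤ s} = Haar^{Fol}{U | periodicChartDeficit (C, U) ≤ s}` — the hypothesis of the periodic leader chart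
✓`lintegral_haar_four_eq_periodicLeaderChart`. [cite: tHooft1979] -/
theorem pi_periodicChartDeficit_le_conj (z : Fin 3 → Bool) {χ : Site 3 L → SU2} (hχ : ∀ (x : Site 3 L) (k : SU2), k * χ x = χ x * k) (k : SU2)
    (C : Fin 4 → SU2) (s : ℝ) :
    (Measure.pi fun _ : Fol L => haarProbability SU2) {U | periodicChartDeficit L z χ ((fun m => k * C m * k⁻¹), U) ≤ s} =
      (Measure.pi fun _ : Fol L => haarProbability SU2) {U | periodicChartDeficit L z χ (C, U) ≤ s} := by
  have hT : MeasurableSet {U : Fol L → SU2 | periodicChartDeficit L z χ (C, U) ≤ s} :=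
    measurableSet_le ((measurable_periodicChartDeficit z χ).comp (measurable_const.prodMk measurable_id)) measurable_const
  have hset : {U : Fol L → SU2 | periodicChartDeficit L z χ ((fun m => k * C m * k⁻¹), U) ≤ s} =
      (fun (U : Fol L → SU2) (i : Fol L) => k⁻¹ * U i * k⁻¹⁻¹) ⁻¹' {U | periodicChartDeficit L z χ (C, U) ≤ s} := by
    ext U
    simp only [Set.mem_preimage, Set.mem_setOf_eq]
    have h := periodicChartDeficit_conj z hχ k⁻¹ ((fun m => k * C m * k⁻¹), U)
    have hC : (fun m => k⁻¹ * (k * C m * k⁻¹) * k⁻¹⁻¹) = C := by funext m; group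
    simp only [hC] at h
    rw [← h]
  rw [hset]
  exact (measurePreserving_conj_fol (L := L) k⁻¹).measure_preimage hT.nullMeasurableSet

/-- ★★ **THE PERIODIC SUBLEVEL VOLUMES IN LEADER ∕ FOLLOWER COORDINATES, EXACTLY**:
`μ_L{F_z ≤ s} = (Haar⁴ ⊗ Haar^{Fol}){q | periodicChartDeficit z χ q ≤ s}` (w2 g57's ✓`lintegral_ringMeasure_eq_chart` with `κ = id`, invariance
✓`ringDeficit_ringGaugeAct`). [cite: tHooft1979] [cite: Luscher1983, §2] [cite: SeilerLNP1982, §2] -/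
theorem ringMeasure_ringDeficit_le_eq_chart (z : Fin 3 → Bool) (χ : Site 3 L → SU2) (s : ℝ) :
    (ringMeasure L) {P | ringDeficit L z P ≤ s} =
      ((Measure.pi fun _ : Fin 4 => haarProbability SU2).prod (Measure.pi fun _ : Fol L => haarProbability SU2))
        {q | periodicChartDeficit L z χ q ≤ s} := by
  have hS : MeasurableSet {P : (Fin (2 * L - 1 + 1) → GaugeConfig 3 L SU2) × (Site 3 L → SU2) | ringDeficit L z P ≤ s} :=
    measurableSet_le (measurable_ringDeficit z) measurable_const
  have hT : MeasurableSet {q : (Fin 4 → SU2) × (Fol L → SU2) | periodicChartDeficit L z χ q ≤ s} :=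
    measurableSet_le (measurable_periodicChartDeficit z χ) measurable_const
  rw [← lintegral_indicator_one hS, ← lintegral_indicator_one hT]
  rw [lintegral_ringMeasure_eq_chart (id : Site 3 L → Site 3 L) χ (measurable_one.indicator hS)
    (fun h p => by simp only [Function.comp_id, Set.indicator_apply, Set.mem_setOf_eq, ringDeficit_ringGaugeAct, Pi.one_apply])]
  refine lintegral_congr fun q => ?_
  simp only [Set.indicator_apply, Set.mem_setOf_eq, periodicChartDeficit, Pi.one_apply]

/-- The periodic inner mass `C ↦ Haar^{Fol}{U | periodicChartDeficit (C, U) ≤ s}` is measurable. [folklore] -/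
theorem measurable_pi_periodicChartDeficit_le (z : Fin 3 → Bool) (χ : Site 3 L → SU2) (s : ℝ) :
    Measurable fun C : Fin 4 → SU2 => (Measure.pi fun _ : Fol L => haarProbability SU2) {U | periodicChartDeficit L z χ (C, U) ≤ s} :=
  measurable_measure_prodMk_left (measurableSet_le (measurable_periodicChartDeficit z χ) measurable_const)

/-- ★★ **FUBINI FORM**: `μ_L{F_z ≤ s} = ∫ Haar^{Fol}{U | periodicChartDeficit z χ (C, U) ≤ s} dHaar⁴(C)`. [cite: tHooft1979] [cite: Luscher1983, §2] -/
theorem ringMeasure_ringDeficit_le_eq_lintegral (z : Fin 3 → Bool) (χ : Site 3 L → SU2) (s : ℝ) :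
    (ringMeasure L) {P | ringDeficit L z P ≤ s} =
      ∫⁻ C, (Measure.pi fun _ : Fol L => haarProbability SU2) {U | periodicChartDeficit L z χ (C, U) ≤ s}
        ∂(Measure.pi fun _ : Fin 4 => haarProbability SU2) := by
  have hT : MeasurableSet {q : (Fin 4 → SU2) × (Fol L → SU2) | periodicChartDeficit L z χ q ≤ s} :=
    measurableSet_le (measurable_periodicChartDeficit z χ) measurable_const
  rw [ringMeasure_ringDeficit_le_eq_chart z χ, Measure.prod_apply hT]
  rfl

/-! ## §2 The periodic blow-up point and event -/

/-- **The periodic chart point of a blow-up point** `x = (a, (w, y))` at scale `t`: leaders `axialLetters (a, dil3P t w)` (✓PJ2: `(Q x', Q z', Q y', Q(axisPoint a))`,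
`((x', y'), z') = dil3P t w`, all three transversally dilated), followers `U_i = Q (dilateIm t (y i))` (relative coordinates, centres `1`). [folklore] -/
def periodicBlowUpPoint (t : ℝ) (x : ℍ × (((ℍ × ℍ) × ℍ) × (Fol L → ℍ))) : (Fin 4 → SU2) × (Fol L → SU2) :=
  (axialLetters (x.1, dil3P t x.2.1), fun i => quatToSU2 (dilateIm t (x.2.2 i)))

variable (L) in
/-- **The periodic blow-up event** `E_P(t, s)`: dilated letters in the cone-model balls and `F_z` of the rebuilt ring history `≤ s`. [folklore] -/
def periodicBlowUpSet (z : Fin 3 → Bool) (χ : Site 3 L → SU2) (t s : ℝ) : Set (ℍ × (((ℍ × ℍ) × ℍ) × (Fol L → ℍ))) :=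
  {x | dil3P t x.2.1 ∈ ball3 ∧ (∀ i, ‖dilateIm t (x.2.2 i)‖ < 1) ∧ periodicChartDeficit L z χ (periodicBlowUpPoint t x) ≤ s}

omit [NeZero L] in
/-- `periodicBlowUpPoint t` is measurable. [folklore] -/
theorem measurable_periodicBlowUpPoint (t : ℝ) : Measurable (periodicBlowUpPoint (L := L) t) := by
  refine Measurable.prodMk ?_ ?_
  · exact measurable_axialLetters.comp (measurable_fst.prodMk ((measurable_dil3P t).comp (measurable_fst.comp measurable_snd)))
  · exact measurable_pi_lambda _ fun i =>
      measurable_quatToSU2.comp ((continuous_dilateIm t).measurable.comp ((measurable_pi_apply i).comp (measurable_snd.comp measurable_snd)))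

/-- `periodicBlowUpSet` is measurable. [folklore] -/
theorem measurableSet_periodicBlowUpSet (z : Fin 3 → Bool) (χ : Site 3 L → SU2) (t s : ℝ) : MeasurableSet (periodicBlowUpSet L z χ t s) := by
  have h1 : MeasurableSet {x : ℍ × (((ℍ × ℍ) × ℍ) × (Fol L → ℍ)) | dil3P t x.2.1 ∈ ball3} :=
    measurableSet_ball3.preimage ((measurable_dil3P t).comp (measurable_fst.comp measurable_snd))
  have h2 : MeasurableSet {x : ℍ × (((ℍ × ℍ) × ℍ) × (Fol L → ℍ)) | ∀ i, ‖dilateIm t (x.2.2 i)‖ < 1} :=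
    (measurableSet_followerBalls (L := L) t).preimage (measurable_snd.comp measurable_snd)
  have h3 : MeasurableSet {x : ℍ × (((ℍ × ℍ) × ℍ) × (Fol L → ℍ)) | periodicChartDeficit L z χ (periodicBlowUpPoint t x) ≤ s} :=
    measurableSet_le ((measurable_periodicChartDeficit z χ).comp (measurable_periodicBlowUpPoint t)) measurable_const
  exact (h1.inter (h2.inter h3)).congr (by ext x; simp only [periodicBlowUpSet, Set.mem_inter_iff, Set.mem_setOf_eq])

/-! ## §3 The inner mass through the follower chart -/

/-- ★ **THE PERIODIC INNER MASS THROUGH THE FOLLOWER CHART** (centres `≡ 1`): for every `t > 0`,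
`Haar^{Fol}{U | periodicChartDeficit (C, U) ≤ s} = ofReal(coneConst^{6L⁴−3} · t^{3(6L⁴−3)}) · vol^{Fol}{y | (∀ i, ‖D³_t y_i‖ < 1) ∧ periodicChartDeficit (C, Q∘D³_t∘y) ≤ s}`.
[folklore] -/
theorem pi_periodicChartDeficit_le_eq_followerChart (z : Fin 3 → Bool) (χ : Site 3 L → SU2) (C : Fin 4 → SU2) (s : ℝ) {t : ℝ} (ht : 0 < t) :
    (Measure.pi fun _ : Fol L => haarProbability SU2) {U | periodicChartDeficit L z χ (C, U) ≤ s} =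
      ENNReal.ofReal (coneConst ^ (6 * L ^ 4 - 3) * t ^ (3 * (6 * L ^ 4 - 3))) *
        (Measure.pi fun _ : Fol L => (volume : Measure ℍ))
          {y | (∀ i, ‖dilateIm t (y i)‖ < 1) ∧ periodicChartDeficit L z χ (C, fun i => quatToSU2 (dilateIm t (y i))) ≤ s} := by
  have hT : MeasurableSet {U : Fol L → SU2 | periodicChartDeficit L z χ (C, U) ≤ s} :=
    measurableSet_le ((measurable_periodicChartDeficit z χ).comp (measurable_const.prodMk measurable_id)) measurable_const
  have hY : MeasurableSet {y : Fol L → ℍ | (∀ i, ‖dilateIm t (y i)‖ < 1) ∧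
      periodicChartDeficit L z χ (C, fun i => quatToSU2 (dilateIm t (y i))) ≤ s} := by
    refine (measurableSet_followerBalls (L := L) t).inter ?_
    exact measurableSet_le ((measurable_periodicChartDeficit z χ).comp (measurable_const.prodMk
      (measurable_pi_lambda _ fun i => measurable_quatToSU2.comp ((continuous_dilateIm t).measurable.comp (measurable_pi_apply i)))))
      measurable_const
  rw [← lintegral_indicator_one hT, ← lintegral_indicator_one hY,
    lintegral_haar_pi_eq_followerChart (fun _ : Fol L => (1 : ℍ)) (fun _ => norm_one) _ (measurable_one.indicator hT) ht, card_fol]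
  congr 1
  refine lintegral_congr fun y => ?_
  simp only [one_mul]
  by_cases h1 : ∀ i, ‖dilateIm t (y i)‖ < 1
  · rw [Set.indicator_of_mem (s := {y : Fol L → ℍ | ∀ i, ‖dilateIm t (y i)‖ < 1}) h1]
    by_cases h2 : periodicChartDeficit L z χ (C, fun i => quatToSU2 (dilateIm t (y i))) ≤ s
    · rw [Set.indicator_of_mem (s := {U : Fol L → SU2 | periodicChartDeficit L z χ (C, U) ≤ s}) h2,
        Set.indicator_of_mem (s := {y : Fol L → ℍ | (∀ i, ‖dilateIm t (y i)‖ < 1) ∧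
          periodicChartDeficit L z χ (C, fun i => quatToSU2 (dilateIm t (y i))) ≤ s}) ⟨h1, h2⟩]
      rfl
    · rw [Set.indicator_of_notMem (s := {U : Fol L → SU2 | periodicChartDeficit L z χ (C, U) ≤ s}) h2,
        Set.indicator_of_notMem (s := {y : Fol L → ℍ | (∀ i, ‖dilateIm t (y i)‖ < 1) ∧
          periodicChartDeficit L z χ (C, fun i => quatToSU2 (dilateIm t (y i))) ≤ s}) (fun h => h2 h.2)]
  · rw [Set.indicator_of_notMem (s := {y : Fol L → ℍ | ∀ i, ‖dilateIm t (y i)‖ < 1}) h1,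
      Set.indicator_of_notMem (s := {y : Fol L → ℍ | (∀ i, ‖dilateIm t (y i)‖ < 1) ∧
        periodicChartDeficit L z χ (C, fun i => quatToSU2 (dilateIm t (y i))) ≤ s}) (fun h => h1 h.1)]

/-! ## §4 The periodic scaling identity, hub outermost -/

/-- The periodic charts' Jacobian exponents: `3 + (6L⁴ − 3) = 6L⁴` and `6 + 3(6L⁴ − 3) = 18L⁴ − 3`. [folklore] -/
theorem periodic_jacobian_exponents : 3 + (6 * L ^ 4 - 3) = 6 * L ^ 4 ∧ 6 + 3 * (6 * L ^ 4 - 3) = 18 * L ^ 4 - 3 := by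
  have h4 : 1 ≤ L ^ 4 := Nat.one_le_pow _ _ (Nat.pos_of_ne_zero (NeZero.ne L))
  omega

/-- ★★★ **THE PERIODIC SUBLEVEL VOLUMES ON THE BLOW-UP SPACE, HUB OUTERMOST**: for central `χ`, every scale `t > 0` and level `s`,
`μ_L{F_z ≤ s} = ofReal(coneConst^{6L⁴} · t^{18L⁴−3}) · ∫⁻ a, ∫⁻ w, vol^{Fol}(section of periodicBlowUpSet z χ t s at (a, w)) dvol³ dcone(a)`
— the form the log-shell (✓`BlowUp.tendsto_div_log_of_twoScale`) consumes: the hub `a` is integrated LAST. [cite: tHooft1979] [cite: Luscher1983, §2] -/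
theorem ringMeasure_ringDeficit_le_eq_hub (z : Fin 3 → Bool) {χ : Site 3 L → SU2} (hχ : ∀ (x : Site 3 L) (k : SU2), k * χ x = χ x * k)
    {t : ℝ} (ht : 0 < t) (s : ℝ) :
    (ringMeasure L) {P | ringDeficit L z P ≤ s} =
      ENNReal.ofReal (coneConst ^ (6 * L ^ 4) * t ^ (18 * L ^ 4 - 3)) *
        ∫⁻ a, ∫⁻ w, (Measure.pi fun _ : Fol L => (volume : Measure ℍ)) (Prod.mk w ⁻¹' (Prod.mk a ⁻¹' periodicBlowUpSet L z χ t s))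
          ∂(volume : Measure ((ℍ × ℍ) × ℍ)) ∂coneMeasure := by
  haveI := isProbabilityMeasure_coneMeasure
  set vF : Measure (Fol L → ℍ) := Measure.pi fun _ : Fol L => (volume : Measure ℍ) with hvF
  set B : ℝ := coneConst ^ (6 * L ^ 4 - 3) * t ^ (3 * (6 * L ^ 4 - 3)) with hB
  -- (1) ring chart + periodic leader chart
  rw [ringMeasure_ringDeficit_le_eq_lintegral z χ s,
    lintegral_haar_four_eq_periodicLeaderChart _ (measurable_pi_periodicChartDeficit_le z χ s) (fun h C => pi_periodicChartDeficit_le_conj z hχ h C s) ht]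
  -- (2) follower chart inside, and the section of the blow-up event over `(a, w)`
  have hsec : ∀ (a : ℍ) (w : (ℍ × ℍ) × ℍ),
      ball3.indicator (fun w' => (Measure.pi fun _ : Fol L => haarProbability SU2) {U | periodicChartDeficit L z χ (axialLetters (a, w'), U) ≤ s}) (dil3P t w) =
        ENNReal.ofReal B * vF (Prod.mk w ⁻¹' (Prod.mk a ⁻¹' periodicBlowUpSet L z χ t s)) := by
    intro a w
    by_cases hb : dil3P t w ∈ ball3
    · rw [Set.indicator_of_mem hb, pi_periodicChartDeficit_le_eq_followerChart z χ _ s ht]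
      congr 2
      ext y
      simp only [periodicBlowUpSet, periodicBlowUpPoint, Set.mem_setOf_eq, Set.mem_preimage, hb, true_and]
    · rw [Set.indicator_of_notMem hb]
      have he : Prod.mk w ⁻¹' (Prod.mk a ⁻¹' periodicBlowUpSet L z χ t s) = ∅ := by
        ext y
        simp only [periodicBlowUpSet, Set.mem_preimage, Set.mem_setOf_eq, hb, false_and, Set.mem_empty_iff_false]
      rw [he, measure_empty, mul_zero]
  simp_rw [hsec]
  have hBtop : ENNReal.ofReal B ≠ ∞ := ENNReal.ofReal_ne_top
  simp_rw [lintegral_const_mul' _ _ hBtop]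
  rw [← mul_assoc]
  congr 1
  have hc0 : 0 ≤ coneConst := by rw [coneConst]; exact ENNReal.toReal_nonneg
  rw [← ENNReal.ofReal_mul (by positivity), hB]
  congr 1
  obtain ⟨h1, h2⟩ := periodic_jacobian_exponents (L := L)
  calc coneConst ^ 3 * t ^ 6 * (coneConst ^ (6 * L ^ 4 - 3) * t ^ (3 * (6 * L ^ 4 - 3)))
      = coneConst ^ (3 + (6 * L ^ 4 - 3)) * t ^ (6 + 3 * (6 * L ^ 4 - 3)) := by rw [pow_add, pow_add]; ring
    _ = coneConst ^ (6 * L ^ 4) * t ^ (18 * L ^ 4 - 3) := by rw [h1, h2]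

/-- ★★★ **THE PERIODIC SUBLEVEL VOLUMES ON THE BLOW-UP SPACE, EXACTLY**: for central `χ`, every `t > 0` and `s`,
`μ_L{F_z ≤ s} = ofReal(coneConst^{6L⁴} · t^{18L⁴−3}) · (cone ⊗ (vol³ ⊗ vol^{Fol}))(periodicBlowUpSet z χ t s)`. [cite: tHooft1979] [cite: Luscher1983, §2] -/
theorem ringMeasure_ringDeficit_le_eq_periodicBlowUp (z : Fin 3 → Bool) {χ : Site 3 L → SU2} (hχ : ∀ (x : Site 3 L) (k : SU2), k * χ x = χ x * k)
    {t : ℝ} (ht : 0 < t) (s : ℝ) :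
    (ringMeasure L) {P | ringDeficit L z P ≤ s} =
      ENNReal.ofReal (coneConst ^ (6 * L ^ 4) * t ^ (18 * L ^ 4 - 3)) *
        (coneMeasure.prod ((volume : Measure ((ℍ × ℍ) × ℍ)).prod (Measure.pi fun _ : Fol L => (volume : Measure ℍ))))
          (periodicBlowUpSet L z χ t s) := by
  haveI := isProbabilityMeasure_coneMeasure
  set vF : Measure (Fol L → ℍ) := Measure.pi fun _ : Fol L => (volume : Measure ℍ) with hvF
  haveI : SigmaFinite vF := by rw [hvF]; infer_instance
  have hE := measurableSet_periodicBlowUpSet z χ t s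
  have hβ : (coneMeasure.prod ((volume : Measure ((ℍ × ℍ) × ℍ)).prod vF)) (periodicBlowUpSet L z χ t s) =
      ∫⁻ a, ∫⁻ w, vF (Prod.mk w ⁻¹' (Prod.mk a ⁻¹' periodicBlowUpSet L z χ t s)) ∂(volume : Measure ((ℍ × ℍ) × ℍ)) ∂coneMeasure := by
    rw [Measure.prod_apply hE]
    refine lintegral_congr fun a => ?_
    rw [Measure.prod_apply (measurable_prodMk_left hE)]
  rw [hβ]
  exact ringMeasure_ringDeficit_le_eq_hub z hχ ht s

/-- ★★ **THE PERIODIC SCALING at `t = √u`**: `μ_L{F_z ≤ r·u} = ofReal(coneConst^{6L⁴} · u^{9L⁴−3/2}) · (cone ⊗ (vol³ ⊗ vol^{Fol}))(periodicBlowUpSet z χ (√u) (r·u))`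
— the periodic exponent `9L⁴ − 3/2` as a REAL power (`(√u)^{18L⁴−3} = u^{(18L⁴−3)/2}`); NO logarithm in the Jacobian: the `log(1/u)` of the periodic law lives in the
`cone ⊗ …`-measure of the event (hub integral, ✓`…_eq_hub`). [cite: tHooft1979] [cite: Luscher1983, §2] -/
theorem ringMeasure_ringDeficit_le_eq_scaling (z : Fin 3 → Bool) {χ : Site 3 L → SU2} (hχ : ∀ (x : Site 3 L) (k : SU2), k * χ x = χ x * k)
    (r : ℝ) {u : ℝ} (hu : 0 < u) :
    (ringMeasure L) {P | ringDeficit L z P ≤ r * u} =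
      ENNReal.ofReal (coneConst ^ (6 * L ^ 4) * u ^ (9 * (L : ℝ) ^ 4 - 3 / 2)) *
        (coneMeasure.prod ((volume : Measure ((ℍ × ℍ) × ℍ)).prod (Measure.pi fun _ : Fol L => (volume : Measure ℍ))))
          (periodicBlowUpSet L z χ (Real.sqrt u) (r * u)) := by
  rw [ringMeasure_ringDeficit_le_eq_periodicBlowUp z hχ (Real.sqrt_pos.2 hu) (r * u)]
  congr 2
  have h4 : 1 ≤ L ^ 4 := Nat.one_le_pow _ _ (Nat.pos_of_ne_zero (NeZero.ne L))
  have hcast : (((18 * L ^ 4 - 3 : ℕ) : ℝ)) = 2 * (9 * (L : ℝ) ^ 4 - 3 / 2) := by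
    rw [Nat.cast_sub (by omega)]; push_cast; ring
  rw [← Real.rpow_natCast (Real.sqrt u) (18 * L ^ 4 - 3), hcast, Real.rpow_mul (Real.sqrt_nonneg u), Real.rpow_two, Real.sq_sqrt hu.le]

end Summit.QuantumFields.YangMills.Theorems.SwapVirialDeficit.BlowUpRing

end
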